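import Summits.BirchSwinnertonDyer.Rank1Residual.Additive.SignedSelmerControlZero
import Literature.NumberTheory.EllipticCurves.IwasawaCoinvariantsRankProofs
import Mathlib.GroupTheory.QuotientGroup.Finite
import HarnessLib

/-!
# `f_E(0) ≠ 0 ⇒ Sel_{p^∞}(E/K)` is finite — the finiteness half of Mazur's control theorem at the
# bottom layer, for the classical `p^∞`-Selmer group over any `ℤ_p`-extension (cell `b2b-bsdres`, line V19)

HONEST FRAMING (cell `b2b-bsdres`, run/shared/lean/b2b/bsd-rank1-residual/, verbatim in every
file): the goal of the cell is to DELETE the COMBINATION-SHAPED residual classes of the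
Birch–Swinnerton-Dyer formula for ALL analytic-rank `≤ 1` elliptic curves over `ℚ` — "full BSD
formula for every rank `≤ 1` curve in class `C`" assembled STRICTLY from published theorems — so
that the rank-`≤ 1` remainder becomes exactly the CONSTRUCTION-SHAPED classes, which are TYPED
(missing-input `Prop`s), NOT attempted. This is not "finishing BSD". Seat additive-p4 (research route
on the construction-shaped additive classes X3/X4); no label moves; nothing is booked here.

Theorems only (no `def`, no `sorry`, no named fact). Line V19 applies Greenberg's Theorem 4.1 over
the number field `F = ℚ(μ_p)` (named fact `Greenberg1999.thm41_charValue_rankZero_numberField`),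
whose standing hypothesis is "`Sel_E(F)_p` is finite". Over `F` of degree `p − 1 ≥ 4` this
finiteness is NOT supplied by Gross–Zagier–Kolyvagin over `ℚ` (the non-quadratic eigenspaces of
`Sel_{p^∞}(E/F)` are invisible from `ℚ`); it is supplied by the main-conjecture divisibility itself:
if `g ∈ char_Λ X(E/F_∞)` has `g(0) ≠ 0` then the generator `f_E` has `f_E(0) ≠ 0`, and then

  `f_E(0) ≠ 0 ⇒ X/TX` finite (Greenberg, proof of Lemma 4.2, p. 103; tree
  `SignedControlZero.finite_invariants_coinvariants_of_constantCoeff_ne_zero`) `⇒ (Sel_∞)^Γ` finite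
  (Pontryagin duality, tree `IsDualPair.finite_coinvariants_iff`) `⇒ Sel_{p^∞}(E/K_0)` finite, since the
  restriction `Sel_{p^∞}(E/K_0) → (Sel_∞)^Γ` has FINITE kernel — it embeds in `H¹(Γ, B) = B/(γ−1)B`,
  `B = E(K_∞)[p^∞]`, which is finite (Greenberg Lemma 3.1, p. 86; tree
  `finite_ker_layerToInfty_and_card_le`, `finite_quotient_subOne`) — and `Sel_{p^∞}(E/K_0) = Sel_{p^∞}(E/K)`.

Result (`SelmerControl.finite_selmerGroupPInfty_of_constantCoeff_ne_zero`): for ANY number field `K`,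
ANY `ℤ_p`-extension `κ` with topological generator `γ`, any Pontryagin-dual datum `D` of
`Sel_{p^∞}(E/K_∞)` with `X` finitely generated torsion and `char X = (f)`: **`f(0) ≠ 0 ⇒ Sel_{p^∞}(E/K)`
is finite** (hence `E(K)` and `Ш(E/K)[p^∞]` are finite, tree `finite_selmerGroupPInfty_iff`). No
hypothesis on `B`, on finite submodules, or on the reduction type (those enter only the QUANTITATIVE
control theorem). Companion of `SignedSelmerControlZero.lean` (line V18, signed Selmer groups, where
`B = 0` was used to get an inequality).

References: [GreenbergLNM1716] R. Greenberg, *Iwasawa theory for elliptic curves*, LNM 1716 (1999),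
§3 Lemma 3.1 (p. 86), §4 Lemma 4.2 (pp. 102–103); B. Mazur, Invent. Math. 18 (1972), §6.
-/

noncomputable section

open scoped Classical

open WeierstrassCurve Literature.NumberTheory.EllipticCurves Literature.NumberTheory.GaloisRepresentations
  Literature.NumberTheory.EllipticCurves.IwasawaAlgebra Literature.NumberTheory.EllipticCurves.IwasawaDual
  ZpExtension

universe u

namespace Summit.BirchSwinnertonDyer.Rank1Residual.Additive

namespace SelmerControl

variable {K : Type u} [Field K] [NumberField K] (W : WeierstrassCurve K) [W.IsElliptic] {p : ℕ}
  [Fact p.Prime] {κ : ZpExtension K p} {γ : Field.absoluteGaloisGroup K}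

/-- **The restriction `Sel_{p^∞}(E/K_0) → H¹(K_∞, E[p^∞])` has finite kernel** (Greenberg, LNM 1716,
Lemma 3.1: `ker h_0 ↪ H¹(Γ, B) = B/(γ − 1)B` with `B = E(K_∞)[p^∞]`, and `B/(γ−1)B` is finite —
tree `finite_ker_layerToInfty_and_card_le` with `finite_quotient_subOne`). [cite: GreenbergLNM1716, §3 Lemma 3.1 (p. 86)] -/
theorem finite_ker_layerToInfty_zero (hγ : κ.IsTopGenerator γ) :
    Finite (W.layerToInfty κ 0).ker := by
  have hγ1 : γ ^ p ^ 0 = γ := by rw [pow_zero, pow_one]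
  haveI : Finite (FixedPoints.addSubgroup κ.kerSubgroup (geomPrimaryTorsion W p) ⧸
      (ResKernel.subOne κ.kerSubgroup (geomPrimaryTorsion W p) (γ ^ p ^ 0)).range) := by
    rw [hγ1]
    exact W.finite_quotient_subOne κ hγ
  exact (W.finite_ker_layerToInfty_and_card_le κ hγ 0).1

/-- **`(Sel_∞)^γ` finite ⇒ `Sel_{p^∞}(E/K)` finite**: the restriction carries
`Sel_{p^∞}(E/K_0) = Sel_{p^∞}(E/K)` into `Sel_∞ ∩ H¹(K_∞, E[p^∞])^{Γ_K} ≃ (Sel_∞)^γ`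
(`map_layerToInfty_selmerLayer_le`, `range_layerToInfty_le_layerInvariants`,
`selmerInftyInfLayerInvariantsZeroEquiv`) with finite kernel (`finite_ker_layerToInfty_zero`).
[cite: GreenbergLNM1716, §3 Lemma 3.1 (p. 86)] -/
theorem finite_selmerGroupPInfty_of_finite_endInvariants (hγ : κ.IsTopGenerator γ)
    (hfin : Finite (endInvariants (W.conjSelmerInfty κ γ - 1))) :
    Finite (W.selmerGroupPInfty p) := by
  -- the target `Sel_∞ ⊓ layerInvariants 0` is finite
  haveI : Finite ↥(W.selmerInfty κ ⊓ W.layerInvariants κ 0) :=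
    Finite.of_equiv _ (W.selmerInftyInfLayerInvariantsZeroEquiv κ hγ).symm
  -- the map `c ↦ h_0 c`
  have hmem : ∀ c : W.selmerLayer κ 0,
      W.layerToInfty κ 0 (c : W.subgroupH1 p (κ.layerSubgroup 0)) ∈
        W.selmerInfty κ ⊓ W.layerInvariants κ 0 := by
    intro c
    refine ⟨W.map_layerToInfty_selmerLayer_le_holds κ 0 ⟨c, c.2, rfl⟩, ?_⟩
    exact W.range_layerToInfty_le_layerInvariants_holds κ 0 ⟨(c : W.subgroupH1 p (κ.layerSubgroup 0)), rfl⟩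
  let φ : W.selmerLayer κ 0 →+ ↥(W.selmerInfty κ ⊓ W.layerInvariants κ 0) :=
    { toFun := fun c ↦ ⟨W.layerToInfty κ 0 (c : W.subgroupH1 p (κ.layerSubgroup 0)), hmem c⟩
      map_zero' := by
        apply Subtype.ext
        simp only [ZeroMemClass.coe_zero, map_zero]
      map_add' := fun a b ↦ by
        apply Subtype.ext
        simp only [AddSubgroup.coe_add, map_add] }
  -- its kernel embeds in `ker h_0`, finite
  haveI hker : Finite (W.layerToInfty κ 0).ker := finite_ker_layerToInfty_zero W hγ
  haveI : Finite φ.ker := by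
    refine Finite.of_injective (fun c : φ.ker ↦ (⟨((c : W.selmerLayer κ 0) : W.subgroupH1 p
      (κ.layerSubgroup 0)), ?_⟩ : (W.layerToInfty κ 0).ker)) ?_
    · have hc := c.2
      rw [AddMonoidHom.mem_ker] at hc ⊢
      exact congrArg (fun z : ↥(W.selmerInfty κ ⊓ W.layerInvariants κ 0) ↦
        (z : W.subgroupH1 p κ.kerSubgroup)) hc
    · intro a b hab
      apply Subtype.ext; apply Subtype.ext
      exact congrArg (fun z : (W.layerToInfty κ 0).ker ↦ (z : W.subgroupH1 p (κ.layerSubgroup 0))) hab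
  haveI : Fintype ↥(W.selmerInfty κ ⊓ W.layerInvariants κ 0) := Fintype.ofFinite _
  haveI : Fintype φ.ker := Fintype.ofFinite _
  haveI : Fintype (W.selmerLayer κ 0) := AddGroup.fintypeOfKerOfCodom φ
  have hlayer : Finite (W.selmerLayer κ 0) := Finite.of_fintype _
  -- `Sel_{p^∞}(E/K_0) ≃ Sel_{p^∞}(E/K)`
  obtain ⟨e⟩ := W.selmerGroupOver_top_holds p
  have key : ∀ (H : Subgroup (Field.absoluteGaloisGroup K)) [H.Normal], H = ⊤ →
      Finite ↥(W.selmerGroupOver p H) → Finite (W.selmerGroupPInfty p) := by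
    rintro H _ rfl h
    exact Finite.of_equiv _ e.toEquiv
  exact key (κ.layerSubgroup 0) κ.layerSubgroup_zero hlayer

/-- **`f(0) ≠ 0 ⇒ Sel_{p^∞}(E/K)` is finite** (Greenberg, LNM 1716, Lemma 4.2 with Lemma 3.1). Let
`E/K` be an elliptic curve over a number field, `κ` any `ℤ_p`-extension of `K` with topological
generator `γ`, `D` a Pontryagin-dual datum of `Sel_{p^∞}(E/K_∞)` with `X` finitely generated and
`Λ`-torsion, `char(X) = (f)`. If `f(0) ≠ 0` then `X/TX` is finite, hence `(Sel_∞)^γ` is finite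
(duality), hence `Sel_{p^∞}(E/K)` is finite (finite-kernel restriction). In line V19 this supplies
the hypothesis "`Sel_E(F)_p` finite" of Greenberg's Theorem 4.1 over `F = ℚ(μ_p)` from the
main-conjecture divisibility (`g = h·f`, `g(0) ≠ 0`). [cite: GreenbergLNM1716, §4 Lemma 4.2 (pp. 102–103)]
[cite: GreenbergLNM1716, §3 Lemma 3.1 (p. 86)] -/
theorem finite_selmerGroupPInfty_of_constantCoeff_ne_zero (hγ : κ.IsTopGenerator γ)
    (D : W.SelmerDualData κ γ) [Module.Finite (IwasawaAlgebra p) D.X] (hX : D.IsTorsion)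
    {f : IwasawaAlgebra p} (hf : D.charIdeal = Ideal.span {f})
    (h0 : PowerSeries.constantCoeff f ≠ 0) :
    Finite (W.selmerGroupPInfty p) := by
  obtain ⟨-, hcoinv⟩ :=
    SignedControlZero.finite_invariants_coinvariants_of_constantCoeff_ne_zero p D.X hX f hf h0
  have hfin : Finite (endInvariants (W.conjSelmerInfty κ γ - 1)) :=
    (SelmerDualData.isDualPair W D hγ).finite_coinvariants_iff.mp hcoinv
  exact finite_selmerGroupPInfty_of_finite_endInvariants W hγ hfin

/-- Same, with the non-vanishing read off a MULTIPLE of the generator: if `g ∈ char(X)` and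
`g(0) ≠ 0` then `Sel_{p^∞}(E/K)` is finite (`g = h · f` with `(f) = char X` principal, so
`f(0) ≠ 0`). This is the form in which the main-conjecture divisibility
(`ι g = u · L_p`, `L_p(0) ≠ 0`) is consumed. [cite: GreenbergLNM1716, §4 Lemma 4.2 (pp. 102–103)] -/
theorem finite_selmerGroupPInfty_of_mem_charIdeal (hγ : κ.IsTopGenerator γ)
    (D : W.SelmerDualData κ γ) [Module.Finite (IwasawaAlgebra p) D.X] (hX : D.IsTorsion)
    {g : IwasawaAlgebra p} (hg : g ∈ D.charIdeal) (h0 : PowerSeries.constantCoeff g ≠ 0) :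
    Finite (W.selmerGroupPInfty p) := by
  haveI : (Module.charIdeal (IwasawaAlgebra p) D.X).IsPrincipal := charIdeal_isPrincipal_holds p D.X
  obtain ⟨f, hchar⟩ := Submodule.IsPrincipal.principal (Module.charIdeal (IwasawaAlgebra p) D.X)
  have hchar' : D.charIdeal = Ideal.span {f} := hchar
  have hg' : g ∈ Ideal.span {f} := by rw [← hchar']; exact hg
  obtain ⟨h, hgh⟩ := Ideal.mem_span_singleton'.mp hg'
  have hf0 : PowerSeries.constantCoeff f ≠ 0 := by
    intro h0'
    apply h0
    rw [← hgh, map_mul, h0', mul_zero]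
  exact finite_selmerGroupPInfty_of_constantCoeff_ne_zero W hγ D hX hchar' hf0

end SelmerControl

end Summit.BirchSwinnertonDyer.Rank1Residual.Additive

end
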